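/- Copyright: the b2b-balaban cell (near-miss cell 7), T⁴-continuum fan-out; row NE7b CRUX team (2), seat
t4-ne7b-formalise-leaf-02 (gen 31) — the E-side (key readings) part of the row OWNER's INTERFACE REQUEST NE7b IR-49-1
«THE FIBRE DECORATION» (RULING R-OWNER-49-1 (e), `CLAIMS.log` l.33479; SPEC v0∕v0.1 l.33613; OWNER WORD W-ne7bp1-g50-1
(b) + RULING R-OWNER-50-1 «MERGERS ARE UNDECORATED», l.33902), the JUNCTION with the custodian's reading-side bundle
`IndexDecor` (leaf-03 gen 27, `HistoryRealiseCellsRunSupplyFibreWTVS`).  Released under the licence of the surrounding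
project. -/
import Summits.QuantumFields.BalabanUV.T4Continuum.Support.HistoryRealiseCellsRunSupplyFibreWTVS
import Summits.QuantumFields.BalabanUV.T4Continuum.Support.HistoryBankingFibreDecorSlice

/-!
# IR-49-1 «THE FIBRE DECORATION»: the reading's `IndexDecor` BUILT FROM THE KEY SIDE — slice `sliceOf`, slice set
`CslOf`, decoration sets `decG`, the count by `card_decG_eq_ncount`, the injectivity on history pairs

Summits-side support leaf of the T⁴-continuum cell (rung (B)+1 on a FINITE torus only; NOT infinite volume, NOT the
mass gap, NOT the Clay statement; NOT a proof of the spine estimate NE7b — the cell's OWN estimate, NOT PRINTED, NOT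
PROVED).  [folklore] ONE constructor of the custodian's hypothesis record
`HistoryRealiseCellsRunSupplyFibreWTVS.IndexDecor` from the E-side kernel objects (`HistoryBankingFibreDecorKeys.decG`,
`card_decG_eq_ncount`, `ncount_mono_of_events`; `HistoryBankingFibreDecorSlice.SIdx`, `sliceOf`, `CslOf`,
`sliceOf_mem_CslOf`, `hinj_of_histPair`) plus the reading's REMAINING displays, and its corollary BY NAME
(`fibreMass_of_indexDecor`); no new `structure`, no `[cite:]` tag, nothing printed asserted, no `Prop` fact minted, zero
`sorry`.  B16 = [Balaban1989LargeFieldII] is a manuscript UNDER AUDIT; (1.71)∕(1.72) pp. 378–379, p. 380, pp. 383∕384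
are LOCATORS of hypothesis SHAPES only.

WHY.  `IndexDecor` (SPEC IR-49-1 §2) carries SIX data (`Dec dec Csl slice v N`) and NINE displays; the E-side part of
the request (§4: what the decoration READS on the key) turns FIVE of the fifteen into kernel objects — the slice of a
term of M2-A's index IS `⟨K, a, c⟩` (`sliceOf`), the slice set of a class IS the image of its fibre (`CslOf`, so `hsl`
is a theorem), a member's decoration set IS its genealogy decorated by per-event choice words (`decG (C K w) w.2.1`,
so `card_Dec` is the EQUALITY `card_decG_eq_ncount` followed by node-wise monotonicity under a member-free letter
`N K e`), and the joint injectivity need only be DISPLAYED on the history pair `(h, ℓ)` at fixed `(a, c)`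
(`hinj_of_histPair`).  What the READING still owes, and this constructor takes as hypotheses WITH LOCATORS: the
per-member per-event choice words `C K w e` (e.g. `flagWords (Q K w e) (m K e)` — pairs of subsets of the member's
cubes at `e` per level of the event's window, (1.71) p. 378 ∕ p. 380; at a merger NOTHING is written, R-OWNER-50-1, so
`C K w (·,2,·)` is a singleton and `N K (·,2,·) = 1`), the decoration map `dec` with `hmem` and the injectivity on
history pairs (ρ1, R-class: «(1.72)'s inner index restricted to the components IS the per-component admissible
sequences»), `died_empty` (ρ0, D-46-1), the slice envelope `v` with `envelope` and `hW` over the slices met in the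
fibre (ρ2, PARAMETRIC, (1.90)∕(1.97)–(1.100) pp. 388–390), the count letters `#(C K w e) ≤ N K e` on the member's
events and the share check `hN` (ρ3, NEEDS-CONSTANT FIBRE-1 — CLOSED AS SERVED, R-OWNER-49-2).

WHAT.  §1 the key-side data + the reading's remaining displays as section variables (with locators); §2
**`indexDecor_of_keySide`** — the constructor, at the custodian's generality (`cellOf`, `phys`, `jstar` generic;
`δ := Gen (PEv × β)`, `κ := SIdx I`); §3 **`fibreMass_of_keySide`** := `fibreMass_of_indexDecor` on it (at the (α)
carriers `cellA`∕`physA`∕`jhalf`, `hρ_of_indexDecor (indexDecor_of_keySide …)` has VERBATIM the type of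
`HistReadDataL(W).hρ`).

HONEST SCOPE.  By-name composition of two hypothesis bundles over OUR carriers; nothing of Bałaban's asserted,
instantiated or discharged; the record twin with `hρ` replaced (D-50-1 «THE DECORATED RECORD») is the custodian's.
NE7b NOT PRINTED ∕ NOT PROVED; spine 0∕9.  HONEST DEPENDENCY (cell): continuum YM on T⁴ ⇐ BetaPertH ∧ nine spine
estimates (0/9 proved); BetaPertH ⇐ (D1) ∧ (D4) ∧ CAP+tail; G-an2-4 gates asym, D1 and NE2/3/4.  This file changes
none of it.
-/

open Finset
open Literature.MathematicalPhysics.QuantumFieldTheory.Balaban1983to89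
open T4PersistenceDictionary T4LiveClassFibration
open Summit.QuantumFields.BalabanUV.T4Continuum.HistoryGenealogyRealise
open Summit.QuantumFields.BalabanUV.T4Continuum.HistoryAssemblyPedigree
open Summit.QuantumFields.BalabanUV.T4Continuum.HistoryAssemblyMult
open Summit.QuantumFields.BalabanUV.T4Continuum.HistoryAssemblyMultKey
open Summit.QuantumFields.BalabanUV.T4Continuum.HistoryPriceNodeSum
open Summit.QuantumFields.BalabanUV.T4Continuum.HistoryPriceKeys
open Summit.QuantumFields.BalabanUV.T4Continuum.HistoryBankingDiscountCharge
open Summit.QuantumFields.BalabanUV.T4Continuum.HistoryBankingFibreResum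
open Summit.QuantumFields.BalabanUV.T4Continuum.HistoryBankingFibreDecorKeys
open Summit.QuantumFields.BalabanUV.T4Continuum.HistoryBankingFibreDecorSlice
open Summit.QuantumFields.BalabanUV.T4Continuum.B16HistoryIndexedRepr
open Summit.QuantumFields.BalabanUV.T4Continuum.HistoryRealiseCellsRunSupplyWTVS
open Summit.QuantumFields.BalabanUV.T4Continuum.HistoryRealiseCellsRunAssemblyWTVSData
open Summit.QuantumFields.BalabanUV.T4Continuum.HistoryRealiseCellsRunSupplyFibreWTVS

namespace Summit.QuantumFields.BalabanUV.T4Continuum.HistoryRealiseCellsRunSupplyFibreKeysWTVS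

noncomputable section

set_option synthInstance.maxSize 1024

variable {DomK : ℕ → Type*} {I : (K : ℕ) → HIndex (DomK K)} {d : ℕ} {γ δ' : Type*} [DecidableEq γ] [DecidableEq δ']
  {β : Type} [DecidableEq β]

/-! ## §1 The key-side data and the reading's remaining displays (section variables) -/

section KeySide

variable (ℛ : HistReading I d) (Φf : HistFactors I d) (l₀ : ℝ) (K₀ : ℕ) (W : ℕ → ℝ)
  (φB : ℕ → ℕ → ℕ → ℝ) (φR : ℕ → ℕ → ℝ) (cellOf : ℕ → HIndex.Idx I → ℕ × Lab d → γ)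
  (phys : ℕ → HIndex.Idx I → ℕ × Lab d → δ') (jstar : ℕ → ℕ)
  -- the key-side data of the reading: per-member per-event choice words (NONEMPTY at every event of the member — a
  -- singleton at mergers, R-OWNER-50-1 —, else `decG (C K w) w.2.1 = ∅` and `hmem` is refutable on a nonempty fibre:
  -- leaf-01 g36 INFO-1), member-free count letters, the decoration map (values: decorated genealogies), the slice
  -- envelope on the slice index type
  (C : ℕ → γ × Gen PEv × δ' → PEv → Finset β) (N : ℕ → PEv → ℕ)
  (dec : ℕ → HIndex.Idx I → γ × Gen PEv × δ' → Gen (PEv × β))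
  (v : ℕ → ℝ → Finset (γ × Gen PEv × δ') → SIdx I → ℝ)
  -- (ρ0) no dead indices [B16 pp. 378–379, D-46-1]
  (died_empty : ∀ K, K₀ ≤ K → ∀ τ ∈ HIndex.termSet I K, ∀ j, j < K → (ℛ.inputOf.run K τ).histV.died j = ∅)
  -- (ρ1) the decoration of a fibre term at a member is a decorated copy of the member's genealogy [p. 378 (1.71)]
  (hmem : ∀ K, K₀ ≤ K →
    ∀ k ∈ badGMems (memOf ℛ.inputOf.pedV ℛ.inputOf.liveCV cellOf) jstar (HIndex.termSet I)
        (kmemOf ℛ.inputOf.pedV ℛ.inputOf.liveCV cellOf phys) K,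
      ∀ τ ∈ fibre (kmemOf ℛ.inputOf.pedV ℛ.inputOf.liveCV cellOf phys) (HIndex.termSet I) K k,
        ∀ w ∈ k, dec K τ w ∈ decG (C K w) w.2.1)
  -- (ρ1) at fixed outer and curly summand the HISTORY PAIR is determined by the decorations [pp. 378–379 (1.71)∕(1.72)]
  (hinjPair : ∀ K, K₀ ≤ K →
    ∀ k ∈ badGMems (memOf ℛ.inputOf.pedV ℛ.inputOf.liveCV cellOf) jstar (HIndex.termSet I)
        (kmemOf ℛ.inputOf.pedV ℛ.inputOf.liveCV cellOf phys) K,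
      ∀ (a : (I K).Adm) (c : (I K).HC) (p p' : (I K).HZ × (I K).HL),
        (⟨K, a, (p.1, p.2, c)⟩ : HIndex.Idx I) ∈
            fibre (kmemOf ℛ.inputOf.pedV ℛ.inputOf.liveCV cellOf phys) (HIndex.termSet I) K k →
        (⟨K, a, (p'.1, p'.2, c)⟩ : HIndex.Idx I) ∈
            fibre (kmemOf ℛ.inputOf.pedV ℛ.inputOf.liveCV cellOf phys) (HIndex.termSet I) K k →
        (∀ w ∈ k, dec K ⟨K, a, (p.1, p.2, c)⟩ w = dec K ⟨K, a, (p'.1, p'.2, c)⟩ w) → p = p')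
  -- (ρ2) the curly ∕ last-exponent envelope per slice, summed over the slices met in the fibre [pp. 388–390]
  (v_nonneg : ∀ K t k, ∀ s ∈ CslOf I (kmemOf ℛ.inputOf.pedV ℛ.inputOf.liveCV cellOf phys) K k, 0 ≤ v K t k s)
  (envelope : ∀ K t, |t| ≤ l₀ → K₀ ≤ K →
    ∀ k ∈ badGMems (memOf ℛ.inputOf.pedV ℛ.inputOf.liveCV cellOf) jstar (HIndex.termSet I)
        (kmemOf ℛ.inputOf.pedV ℛ.inputOf.liveCV cellOf phys) K,
      ∀ (a : (I K).Adm) (h : (I K).HZ) (l : (I K).HL) (c : (I K).HC),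
        (⟨K, a, (h, l, c)⟩ : HIndex.Idx I) ∈
            fibre (kmemOf ℛ.inputOf.pedV ℛ.inputOf.liveCV cellOf phys) (HIndex.termSet I) K k →
          |Φf.wC K t a c| * Real.exp (Φf.BV K t a h l c) ≤ v K t k ⟨K, a, c⟩)
  (hW : ∀ K t, |t| ≤ l₀ → K₀ ≤ K →
    ∀ k ∈ badGMems (memOf ℛ.inputOf.pedV ℛ.inputOf.liveCV cellOf) jstar (HIndex.termSet I)
        (kmemOf ℛ.inputOf.pedV ℛ.inputOf.liveCV cellOf phys) K,
      ∑ s ∈ CslOf I (kmemOf ℛ.inputOf.pedV ℛ.inputOf.liveCV cellOf phys) K k, v K t k s ≤ W K)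
  -- (ρ3) member-free count letters over the member's events [p. 383], and the share check (FIBRE-1)
  (hCN : ∀ K, K₀ ≤ K →
    ∀ k ∈ badGMems (memOf ℛ.inputOf.pedV ℛ.inputOf.liveCV cellOf) jstar (HIndex.termSet I)
        (kmemOf ℛ.inputOf.pedV ℛ.inputOf.liveCV cellOf phys) K,
      ∀ w ∈ k, ∀ e ∈ w.2.1.events, (C K w e).card ≤ N K e)
  (hN : ∀ K e, ((N K e : ℕ) : ℝ) ≤ Real.exp (sharpT (φB K) (φR K) e))

include died_empty hmem hinjPair v_nonneg envelope hW hCN hN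

/-! ## §2 The constructor -/

/-- **THE READING's `IndexDecor` BUILT FROM THE KEY SIDE**: slice `:= sliceOf`, slice set `:= CslOf` (so `hsl` is the
theorem `sliceOf_mem_CslOf`), decoration sets `:= decG (C K w) w.2.1` (so `card_Dec` is `card_decG_eq_ncount` followed
by `ncount_mono_of_events` under the member-free letter `N K e`), joint injectivity from its HISTORY-PAIR form
(`hinj_of_histPair`); the READING's displays — `hmem`, `hinjPair` (ρ1), `died_empty` (ρ0), `v_nonneg`, `envelope`,
`hW` (ρ2), `hCN`, `hN` (ρ3) — pass through WITH THEIR LOCATORS. [folklore] -/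
def indexDecor_of_keySide : IndexDecor ℛ Φf l₀ K₀ W φB φR cellOf phys jstar (Gen (PEv × β)) (SIdx I) where
  Dec := fun K w => decG (C K w) w.2.1
  dec := dec
  Csl := fun K k => CslOf I (kmemOf ℛ.inputOf.pedV ℛ.inputOf.liveCV cellOf phys) K k
  slice := fun _ _ => sliceOf I
  v := v
  N := N
  died_empty := died_empty
  hsl := fun _ _ _ _ _ hτ => sliceOf_mem_CslOf hτ
  hmem := hmem
  hinj := fun K hK k hk => hinj_of_histPair _ K k (dec K) (hinjPair K hK k hk)
  v_nonneg := v_nonneg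
  envelope := fun K t ht hK k hk a h l c hτ => by
    rw [sliceOf_mk]
    exact envelope K t ht hK k hk a h l c hτ
  hW := hW
  card_Dec := fun K hK k hk w hw => by
    rw [card_decG_eq_ncount]
    exact ncount_mono_of_events _ _ _ (hCN K hK k hk w hw)
  hN := hN

/-! ## §3 The junction by name -/

/-- **(ρ) `FibreMass` OF THE READING FROM THE KEY-SIDE DATA** — the custodian's `fibreMass_of_indexDecor` on the
constructor: `∑ τ ∈ fibre …, dmassOf ℛ Φf t τ ≤ W K * MULTOf (sharpT (φB K) (φR K)) k` for every bad key class (at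
`cellOf := cellA …`, `phys := physA …`, `jstar := jhalf` this is VERBATIM the type of `HistReadDataL(W).hρ`, as
`hρ_of_indexDecor (indexDecor_of_keySide …)`). [folklore] -/
theorem fibreMass_of_keySide :
    ∀ K t, |t| ≤ l₀ → K₀ ≤ K →
      ∀ k ∈ badGMems (memOf ℛ.inputOf.pedV ℛ.inputOf.liveCV cellOf) jstar (HIndex.termSet I)
          (kmemOf ℛ.inputOf.pedV ℛ.inputOf.liveCV cellOf phys) K,
        ∑ τ ∈ fibre (kmemOf ℛ.inputOf.pedV ℛ.inputOf.liveCV cellOf phys) (HIndex.termSet I) K k,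
          dmassOf ℛ Φf t τ ≤ W K * MULTOf (sharpT (φB K) (φR K)) k :=
  fibreMass_of_indexDecor
    (indexDecor_of_keySide ℛ Φf l₀ K₀ W φB φR cellOf phys jstar C N dec v died_empty hmem hinjPair v_nonneg envelope
      hW hCN hN)

end KeySide

/-! ## §4 (v1.1, append-only) NONEMPTY CHOICE WORDS BY NAME: what the (ρ1) display `hmem` forces on a met member

R-OWNER-50-1 ∕ leaf-01 g36 INFO-1 («choice sets NONEMPTY at every event») was a docstring word of §1; here it is a
consequence of `hmem`: a decoration EXISTS in `decG (C K w) w.2.1` only if EVERY event of the member's genealogy has a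
nonempty choice set (at a merger FILE 1's share check caps it at ONE word — `…SanityLWK` §12b; F-ne7bleaf02-g32-1: no
Euclidean `r`-letter is sought at any node, (1.71)'s `r` being averaged).  [folklore], generic in the letters. -/

section Consequences

variable {ε β' : Type*}

/-- the node count at the constant letter `0` vanishes — every genealogy has at least one node [folklore] -/
theorem ncount_zero : ∀ G : Gen ε, ncount (fun _ => 0) G = 0
  | Gen.born _ _ => ncount_born _ _ _
  | Gen.renew G _ _ => by rw [ncount_renew, Nat.mul_zero]
  | Gen.merge X Y _ => by rw [ncount_merge, Nat.mul_zero]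

variable [DecidableEq ε] [DecidableEq β']

/-- **A DECORATED MEMBER HAS A NONEMPTY CHOICE SET AT EVERY ONE OF ITS EVENTS**: `G' ∈ decG C G` ⇒ `(C e).Nonempty` for
every `e ∈ G.events` — the letter `G'` carries at that node is the witness (`snd_mem_of_mem_decG`). [folklore] -/
theorem nonempty_choice_of_mem_decG (C : ε → Finset β') {G : Gen ε} {G' : Gen (ε × β')} (h : G' ∈ decG C G)
    (e : ε) (he : e ∈ G.events) : (C e).Nonempty := by
  have hG := ZoneSkeleton.events_gmap (Prod.fst : ε × β' → ε) G'
  rw [gmap_fst_of_mem_decG C h] at hG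
  rw [hG, Finset.mem_image] at he
  obtain ⟨n, hn, rfl⟩ := he
  exact ⟨n.2, snd_mem_of_mem_decG C h n hn⟩

/-- **EMPTY CHOICE SETS DECORATE NOTHING**: `decG (fun _ => ∅) G = ∅` for every shape (`card_decG_eq_ncount` at the
letter `0`). [folklore] -/
theorem decG_empty (G : Gen ε) : decG (fun _ => (∅ : Finset β')) G = ∅ := by
  rw [← Finset.card_eq_zero, card_decG_eq_ncount]
  exact (congrArg (fun N => ncount N G) (funext fun _ => Finset.card_empty)).trans (ncount_zero G)

/-- … and a family empty at ONE event of the member already decorates nothing. [folklore] -/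
theorem decG_eq_empty_of_empty_at (C : ε → Finset β') {G : Gen ε} {e : ε} (he : e ∈ G.events) (hC : C e = ∅) :
    decG C G = ∅ :=
  Finset.eq_empty_of_forall_notMem fun _ h => by simpa [hC] using nonempty_choice_of_mem_decG C h e he

/-- **(ρ1) FORCES NONEMPTY CHOICE WORDS ON INHABITED FIBRES** (R-OWNER-50-1's «NONEMPTY at every event» BY NAME): under
§1's display `hmem`, every member `w` of a bad key class whose fibre holds a term has `(C K w e).Nonempty` at EVERY
event `e` of its genealogy — births, renewals AND mergers (where the share check then makes it a singleton).  On a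
reading with no inhabited bad class (the sanity toys) the statement is vacuous, as `hmem` is. [folklore] -/
theorem nonempty_choice_of_hmem (ℛ : HistReading I d) (K₀ : ℕ) (cellOf : ℕ → HIndex.Idx I → ℕ × Lab d → γ)
    (phys : ℕ → HIndex.Idx I → ℕ × Lab d → δ') (jstar : ℕ → ℕ) (C : ℕ → γ × Gen PEv × δ' → PEv → Finset β)
    (dec : ℕ → HIndex.Idx I → γ × Gen PEv × δ' → Gen (PEv × β))
    (hmem : ∀ K, K₀ ≤ K →
      ∀ k ∈ badGMems (memOf ℛ.inputOf.pedV ℛ.inputOf.liveCV cellOf) jstar (HIndex.termSet I)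
          (kmemOf ℛ.inputOf.pedV ℛ.inputOf.liveCV cellOf phys) K,
        ∀ τ ∈ fibre (kmemOf ℛ.inputOf.pedV ℛ.inputOf.liveCV cellOf phys) (HIndex.termSet I) K k,
          ∀ w ∈ k, dec K τ w ∈ decG (C K w) w.2.1)
    {K : ℕ} (hK : K₀ ≤ K) {k : Finset (γ × Gen PEv × δ')}
    (hk : k ∈ badGMems (memOf ℛ.inputOf.pedV ℛ.inputOf.liveCV cellOf) jstar (HIndex.termSet I)
      (kmemOf ℛ.inputOf.pedV ℛ.inputOf.liveCV cellOf phys) K)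
    {τ : HIndex.Idx I} (hτ : τ ∈ fibre (kmemOf ℛ.inputOf.pedV ℛ.inputOf.liveCV cellOf phys) (HIndex.termSet I) K k)
    {w : γ × Gen PEv × δ'} (hw : w ∈ k) (e : PEv) (he : e ∈ w.2.1.events) : (C K w e).Nonempty :=
  nonempty_choice_of_mem_decG (C K w) (hmem K hK k hk τ hτ w hw) e he

end Consequences

/-! ## §5 (v1.2, append-only) §4 IS SHARP: decorability of a member IS «NONEMPTY choice set at every event»

The converse of `nonempty_choice_of_mem_decG` (leaf-01 g38's X8 probe K10b `decG_nonempty_iff`, `CLAIMS.log` l.35643 —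
credited, here made a tree fact at the author's invitation): if every event of `G` has a nonempty choice set then `G`
HAS a decoration (`card_decG_eq_ncount` and a node count `≥ 1`), so (ρ1)'s demand «`dec K τ w ∈ decG (C K w) w.2.1`
for SOME map `dec`» is satisfiable at a met member EXACTLY when R-OWNER-50-1's word holds at each of its events — the
NONEMPTY normalisation is the whole content of decorability, nothing weaker or stronger.  [folklore], generic letters;
no consumer is claimed (a sharpness certificate for the record's `kdMem`∕`hmem` display). -/

section Sharp

variable {ε β' : Type*} [DecidableEq ε]

/-- a node count whose letters are `≥ 1` ON THE GENEALOGY's OWN EVENTS is `≥ 1` (births read the root letter,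
renewals and mergers multiply factors `≥ 1`; cf. the (A) file's `ncount_mono_of_events`) [folklore] -/
theorem one_le_ncount_of_events (N : ε → ℕ) :
    ∀ G : Gen ε, (∀ e ∈ G.events, 1 ≤ N e) → 1 ≤ ncount N G
  | Gen.born b _, h => by rw [ncount_born]; exact h b (by simp)
  | Gen.renew G e _, h => by
      rw [ncount_renew]
      exact one_le_mul_of_one_le_of_one_le (one_le_ncount_of_events N G fun e' he' => h e' (by simp [he']))
        (h e (by simp))
  | Gen.merge X Y e, h => by
      rw [ncount_merge]
      exact one_le_mul_of_one_le_of_one_le (one_le_mul_of_one_le_of_one_le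
        (one_le_ncount_of_events N X fun e' he' => h e' (by simp [he']))
        (one_le_ncount_of_events N Y fun e' he' => h e' (by simp [he']))) (h e (by simp))

variable [DecidableEq β']

/-- **NONEMPTY CHOICE SETS AT EVERY EVENT DECORATE**: the converse of `nonempty_choice_of_mem_decG` — if `(C e).Nonempty`
for every `e ∈ G.events` then `decG C G` is nonempty (`card_decG_eq_ncount` + `one_le_ncount_of_events`). [folklore] -/
theorem decG_nonempty_of_nonempty_at (C : ε → Finset β') {G : Gen ε} (h : ∀ e ∈ G.events, (C e).Nonempty) :
    (decG C G).Nonempty := by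
  rw [← Finset.card_pos, card_decG_eq_ncount]
  exact one_le_ncount_of_events _ G fun e he => Finset.card_pos.2 (h e he)

/-- **§4 IS SHARP**: a genealogy is decorable by the per-event choice sets `C` IFF every one of its events has a nonempty
choice set — `(decG C G).Nonempty ↔ ∀ e ∈ G.events, (C e).Nonempty`. [folklore] -/
theorem decG_nonempty_iff (C : ε → Finset β') (G : Gen ε) :
    (decG C G).Nonempty ↔ ∀ e ∈ G.events, (C e).Nonempty :=
  ⟨fun ⟨_, hG'⟩ e he => nonempty_choice_of_mem_decG C hG' e he, decG_nonempty_of_nonempty_at C⟩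

/-- … equivalently on the empty side: `decG C G = ∅ ↔ ∃ e ∈ G.events, C e = ∅` (`decG_eq_empty_of_empty_at` is the
`←` half). [folklore] -/
theorem decG_eq_empty_iff (C : ε → Finset β') (G : Gen ε) :
    decG C G = ∅ ↔ ∃ e ∈ G.events, C e = ∅ := by
  rw [← Finset.not_nonempty_iff_eq_empty, decG_nonempty_iff]
  simp only [not_forall, Finset.not_nonempty_iff_eq_empty, exists_prop]

end Sharp

end

end Summit.QuantumFields.BalabanUV.T4Continuum.HistoryRealiseCellsRunSupplyFibreKeysWTVS
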